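import Summits.CriticalPhenomena.PercolationContinuityZ3.Theses.PercQuarantineIslands
import Summits.CriticalPhenomena.PercolationContinuityZ3.Theorems.QuantitativeBGN.Negative.LoadBearing
import HarnessLib.Audit

/-!
# Birth skeleton (BC3) for the crux `HalfSpaceOneArmFourFifths` (stmt-CriticalPhenomena-7071), route `PercQuarantineIslands`

Registrar: planner-skel-stmt-CriticalPhenomena-7071-0 (skeleton-register one-shot, 2026-08-17),
file `Cruxes/HalfSpaceOneArmFourFifths/Lines/birth.lean`.

The crux (FIXED; the route's decl `…Theses.PercQuarantineIslands.HalfSpaceOneArmFourFifths`, rank 3, "H"):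

  `∃ κ C : ℝ, 0 < κ ∧ ∀ h ≥ 1, P_{p_c(ℤ³)}(0 ↔ {x₀ = h} inside {x₀ ≥ 0}) ≤ C · h^{-(4/5+κ)}`

— the HEIGHT form of the boundary one-arm bound with an exponent above the route's threshold `4/5`
(readback `halfSpaceOneArmFourFifths_iff` below, `Iff.rfl`, with `heightReach h` the event spelled out).

THE LINE (the route header's TWO-LAYER PLAN "H ⇐ H1 (scale-uniform half-space crossing bound, a boundary
RSW seed) → H2 (quasi-multiplicativity / renewal of boundary arms turning the seed into a power > 4/5)",
typed in the RADIUS currency, where renewal is honest, and at a general integer ratio `m`):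

* READBACK + REDUCTION (proved here): `heightReach h ⊆ armH h` — reaching the plane `{x₀ = h}` inside `H`
  reaches sup-distance `h` inside `H` (`armH` = the event of the sibling cruxes `QuantitativeBGN` stmt-0913 /
  `HalfSpaceOneArmRate` stmt-6983, Theorems/QuantitativeBGN/Negative). The two forms have the SAME exponent
  `x_s` (a sup-distance-`h` excursion inside `H` either reaches height `≥ h/2`-ish or runs flat under a
  ceiling, both of boundary scaling dimension `x_s`); the height form is weaker only by constants, so nothing
  in the exponent is given away by the reduction.
* `stub_shellSubmult` (p-blind plumbing, PROVABLE NOW, size M; verbatim the registered stub of the sibling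
  skeleton `Cruxes/HalfSpaceOneArmRate/Lines/birth.lean` — ONE proof serves both cruxes): for every `p` and
  `1 ≤ r < R`, `P_p(arm_H(0,R)) ≤ P_p(arm_H(0,r)) · P_p(ShellCross_H(r,R))`,
  `ShellCross_H(r,R) = {∃ w y, ‖w‖∞ ≤ r+1, ‖y‖∞ ≥ R, w ↔ y open inside H ∩ {‖x‖∞ > r}}` (last exit from
  `Λ_r` of an open `H`-path + independence of the disjoint edge sets inside / outside `Λ_r`).
* `stub_shellDecayFourFifths` (the OPEN core, crux-class, LOAD-BEARING): at `p_c(ℤ³)` there are an integer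
  ratio `m ≥ 2`, a scale `r₀ ≥ 1` and an exponent `b > 4/5` with `P_{p_c}(ShellCross_H(r, m r)) ≤ m^{-b}` for
  all `r ≥ r₀` — ONE scale-uniform single-ratio crossing bound in the half-space beating `m^{-4/5}`. Scaling
  prediction `≈ c · m^{-x_s}`, `x_s = 2 − y_hs ≈ 0.975` (Deng–Blöte 2005), margin `0.175` in the exponent (the
  sibling's threshold `1/2` has margin `0.47`; the bulk set-to-sphere exponent `β/ν ≈ 0.477` is useless here —
  the whole content is the WALL's repulsion, quantified). Why it might fail: only through failure of the
  numerical window `x_s > 4/5`; rigorously it is open (RSW / quasi-multiplicativity class in `d = 3`; BGN gives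
  `P(ShellCross_H(r,R)) → 0` as `R → ∞` for FIXED `r` only). Necessarily `b ≤ 2` (`armH_lower_bound` +
  `stub_shellSubmult`), so the stub asks `∃ b ∈ (4/5, 2]` in effect.
* `HalfSpaceOneArmFourFifths_of (h₁ : __Registered.stub_shellSubmult) (h₂ : __Registered.stub_shellDecayFourFifths) :
  HalfSpaceOneArmFourFifths` (PROVED, no `sorry`): the multiscale bookkeeping `rate_of_shell_bound` (induction
  `P(arm_H(0, m^k r₀)) ≤ m^{-bk}`, window `m^k r₀ ≤ r < m^{k+1} r₀` via `Nat.log`, antitonicity of `x ↦ x^{-b}`;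
  adapted verbatim from the sibling skeleton) gives `P(arm_H(0,h)) ≤ (m r₀)^b h^{-b}` for `h ≥ 1`; then
  `κ := b − 4/5 > 0`, `C := (m r₀)^b` and `heightReach h ⊆ armH h`.

Negative knowledge honoured (Theorems/QuantitativeBGN/Negative, same `armH`): `armH_lower_bound`
(`P(arm_H(0,n+1)) ≥ 1/(588 (n+1)²)` ⇒ admissible `b ≤ 2`; likewise the HEIGHT probability is `≥ 1/(6(2h+1)²)`
by `one_le_phi_criticalProbI` + face symmetry, so the crux's `κ` is `≤ 6/5` — both are `∃`, no conflict);
`quantitativeBGN_false_without_rPos` (`armH 0 = univ`: the guards `1 ≤ h`, `1 ≤ r`, `1 ≤ r₀` are kept;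
`ShellCross_H(r, r+1) = univ` is harmless since `m ≥ 2`, `r₀ ≥ 1` are existential); `not_uniform_above`
(everything quantitative sits at `p = p_c` exactly; only the p-blind plumbing stub is uniform in `p`, and it is
true at every `p`). No `Cruxes/HalfSpaceOneArmFourFifths/Disproof.lean` exists (ledger crux ls, 2026-08-17);
`ledger negatives --problem CriticalPhenomena` (11 entries) has no half-space arm / shell-crossing statement.
-/

noncomputable section

namespace Summit.CriticalPhenomena.PercolationContinuityZ3.Cruxes.HalfSpaceOneArmFourFifths.Birth

open MeasureTheory
open Literature.Probability.Percolation Literature.Probability.LatticeModels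
open Summit.CriticalPhenomena.PercolationContinuityZ3.Theses.PercQuarantineIslands (HalfSpaceOneArmFourFifths)
open Summit.CriticalPhenomena.PercolationContinuityZ3.Theorems.QuantitativeBGN.Negative
  (armH armH_antitone)

/-! ## Readback: the height event and its reduction to the radius event -/

/-- The HEIGHT one-arm event of the crux: `0` is joined to the plane `{x₀ = h}` by an open path of the
half-space `H = {x | 0 ≤ x 0}` (verbatim the set in the crux). [folklore] -/
def heightReach (h : ℕ) : Set (BondConfig (Site 3)) :=
  {ω | ∃ y : Site 3, y 0 = (h : ℤ) ∧ ω ∈ openConnIn {x : Site 3 | 0 ≤ x 0} 0 y}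

/-- READBACK: the crux is literally the `h^{-(4/5+κ)}` bound for `heightReach h` under `P_{p_c(ℤ³)}`. [folklore] -/
theorem halfSpaceOneArmFourFifths_iff :
    HalfSpaceOneArmFourFifths ↔ ∃ κ C : ℝ, 0 < κ ∧ ∀ h : ℕ, 1 ≤ h →
      (bondPercolation (zdGraph 3) (criticalProbI 3)).real (heightReach h) ≤ C * (h : ℝ) ^ (-(4 / 5 + κ)) :=
  Iff.rfl

/-- **Height ⊆ radius**: reaching the plane `{x₀ = h}` inside `H` reaches sup-distance `h` inside `H`
(coordinate `0` of the endpoint witnesses `‖y‖∞ ≥ h`). [folklore] -/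
theorem heightReach_subset_armH (h : ℕ) : heightReach h ⊆ armH h := by
  rintro ω ⟨y, hy, hω⟩
  refine ⟨y, ⟨0, ?_⟩, hω⟩
  rw [hy, abs_of_nonneg (by positivity)]

/-- Hence `P(heightReach h) ≤ P(armH h)` under any bond percolation measure on `ℤ³`. [folklore] -/
theorem real_heightReach_le_armH (p : unitInterval) (h : ℕ) :
    (bondPercolation (zdGraph 3) p).real (heightReach h) ≤ (bondPercolation (zdGraph 3) p).real (armH h) :=
  measureReal_mono (heightReach_subset_armH h)

/-! ## The line's one new event and the two stub statements -/

/-- The half-space SHELL-CROSSING event `ShellCross_H(r,R)`: some vertex of sup-norm `≤ r+1` is joined to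
sup-distance `≥ R` by an open path all of whose vertices lie in `H ∩ {‖x‖∞ > r}` (the stubs spell this set
out verbatim; same event as in `Cruxes/HalfSpaceOneArmRate/Lines/birth.lean`). [folklore] -/
def shellCross (r R : ℕ) : Set (BondConfig (Site 3)) :=
  {ω | ∃ w y : Site 3, (∀ i : Fin 3, |w i| ≤ (r : ℤ) + 1) ∧ (∃ i : Fin 3, (R : ℤ) ≤ |y i|) ∧
    ω ∈ openConnIn {x : Site 3 | 0 ≤ x 0 ∧ ∃ i : Fin 3, (r : ℤ) < |x i|} w y}

/-- Statement of `stub_shellSubmult` (named; the registered stub below spells it out verbatim). [folklore] -/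
abbrev ShellSubmultStmt : Prop :=
  ∀ p : unitInterval, ∀ r R : ℕ, 1 ≤ r → r < R →
    (bondPercolation (zdGraph 3) p).real (armH R) ≤
      (bondPercolation (zdGraph 3) p).real (armH r) *
        (bondPercolation (zdGraph 3) p).real
          {ω | ∃ w y : Site 3, (∀ i : Fin 3, |w i| ≤ (r : ℤ) + 1) ∧ (∃ i : Fin 3, (R : ℤ) ≤ |y i|) ∧
            ω ∈ openConnIn {x : Site 3 | 0 ≤ x 0 ∧ ∃ i : Fin 3, (r : ℤ) < |x i|} w y}

/-- Statement of `stub_shellDecayFourFifths` (named; the registered stub below spells it out verbatim). [folklore] -/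
abbrev ShellDecayFourFifthsStmt : Prop :=
  ∃ (m r₀ : ℕ) (b : ℝ), 2 ≤ m ∧ 1 ≤ r₀ ∧ 4 / 5 < b ∧ ∀ r : ℕ, r₀ ≤ r →
    (bondPercolation (zdGraph 3) (criticalProbI 3)).real
        {ω | ∃ w y : Site 3, (∀ i : Fin 3, |w i| ≤ (r : ℤ) + 1) ∧ (∃ i : Fin 3, ((m * r : ℕ) : ℤ) ≤ |y i|) ∧
          ω ∈ openConnIn {x : Site 3 | 0 ≤ x 0 ∧ ∃ i : Fin 3, (r : ℤ) < |x i|} w y} ≤ (m : ℝ) ^ (-b)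

/-- `shellCross` is the event spelled out in the stubs. [folklore] -/
theorem shellCross_eq (r R : ℕ) : shellCross r R =
    {ω | ∃ w y : Site 3, (∀ i : Fin 3, |w i| ≤ (r : ℤ) + 1) ∧ (∃ i : Fin 3, (R : ℤ) ≤ |y i|) ∧
      ω ∈ openConnIn {x : Site 3 | 0 ≤ x 0 ∧ ∃ i : Fin 3, (r : ℤ) < |x i|} w y} := rfl

/-! ## Registered stubs -/

/-- **stub_shellSubmult (p-blind plumbing; provable now; size M).** Half-space arm submultiplicativity across a
shell: for every `p` and `1 ≤ r < R`, `P_p(arm_H(0,R)) ≤ P_p(arm_H(0,r)) · P_p(ShellCross_H(r,R))`. Proof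
sketch: a.s. `ω ⊆ E(ℤ³)`; an open `H`-path from `0` to sup-distance `R` splits at its LAST visit to `Λ_r` —
the piece up to the FIRST vertex of sup-norm `r` is an `H`-arm using only edges with both ends in `Λ_r`, the
piece from the successor of the last `Λ_r`-vertex (sup-norm exactly `r+1`) to the endpoint uses only edges with
both ends outside `Λ_r` and lies in `H ∩ {‖x‖∞ > r}`; disjoint edge sets are independent under the product
measure (`bondPercolation_indep_edgeSigma`). Verbatim the registered stub of the sibling crux
`HalfSpaceOneArmRate` (stmt-6983): prove once, use twice. -/
theorem stub_shellSubmult : ∀ p : unitInterval, ∀ r R : ℕ, 1 ≤ r → r < R →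
    (bondPercolation (zdGraph 3) p).real (armH R) ≤
      (bondPercolation (zdGraph 3) p).real (armH r) *
        (bondPercolation (zdGraph 3) p).real
          {ω | ∃ w y : Site 3, (∀ i : Fin 3, |w i| ≤ (r : ℤ) + 1) ∧ (∃ i : Fin 3, (R : ℤ) ≤ |y i|) ∧
            ω ∈ openConnIn {x : Site 3 | 0 ≤ x 0 ∧ ∃ i : Fin 3, (r : ℤ) < |x i|} w y} := by
  sorry

/-- **stub_shellDecayFourFifths (OPEN core; crux-class; load-bearing).** Quantified half-space shell defect at
`p_c(ℤ³)` beating `m^{-4/5}`: for some integer ratio `m ≥ 2`, scale `r₀ ≥ 1` and exponent `b > 4/5`,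
`P_{p_c}(ShellCross_H(r, m r)) ≤ m^{-b}` for every `r ≥ r₀` (scaling: `≈ c m^{-x_s}`, `x_s ≈ 0.975`, margin
`0.175`; necessarily `b ≤ 2` by `armH_lower_bound` + `stub_shellSubmult`). The `4/5` is the route's
trade-off threshold `(1+a)·(2/3) > 2 − a`; it is the only place the number enters the line. -/
theorem stub_shellDecayFourFifths : ∃ (m r₀ : ℕ) (b : ℝ), 2 ≤ m ∧ 1 ≤ r₀ ∧ 4 / 5 < b ∧ ∀ r : ℕ, r₀ ≤ r →
    (bondPercolation (zdGraph 3) (criticalProbI 3)).real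
        {ω | ∃ w y : Site 3, (∀ i : Fin 3, |w i| ≤ (r : ℤ) + 1) ∧ (∃ i : Fin 3, ((m * r : ℕ) : ℤ) ≤ |y i|) ∧
          ω ∈ openConnIn {x : Site 3 | 0 ≤ x 0 ∧ ∃ i : Fin 3, (r : ℤ) < |x i|} w y} ≤ (m : ℝ) ^ (-b) := by
  sorry

theorem shellSubmult_holds : ShellSubmultStmt := stub_shellSubmult
theorem shellDecayFourFifths_holds : ShellDecayFourFifthsStmt := stub_shellDecayFourFifths

/-! ### Name-keyed aliases of the stub statements
`__Registered.stub_X` is the statement of the registered stub `stub_X` under its short name, so that the native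
skeleton audit (`#h21_check_skeleton`: hypotheses admissible iff registered obligations / declared stubs BY NAME)
accepts `HalfSpaceOneArmFourFifths_of : __Registered.stub_… → … → HalfSpaceOneArmFourFifths` (device of the
`BGNOffTheFloor` / `HalfSpaceOneArmRate` birth skeletons; the `@[stub]` attribute is gate-reserved). -/
namespace __Registered

/-- Alias of `ShellSubmultStmt` keyed by the registered stub name. -/
abbrev stub_shellSubmult : Prop := ShellSubmultStmt
/-- Alias of `ShellDecayFourFifthsStmt` keyed by the registered stub name. -/
abbrev stub_shellDecayFourFifths : Prop := ShellDecayFourFifthsStmt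

end __Registered

/-! ## The multiscale bookkeeping (proved) -/

/-- **Geometric-to-polynomial bookkeeping.** If `P : ℕ → (-∞,1]` is non-increasing and submultiplicative
across shells with factors `Q r R ≥ 0`, and the factor at ratio `m ≥ 2` is at most `m^{-b}` (`b > 0`) from
scale `r₀ ≥ 1` on, then `P r ≤ (m r₀)^b · r^{-b}` for every `r ≥ 1` (adapted verbatim from
`Cruxes/HalfSpaceOneArmRate/Lines/birth.lean`). [folklore] -/
theorem rate_of_shell_bound (P : ℕ → ℝ) (Q : ℕ → ℕ → ℝ)
    (hP1 : ∀ r, P r ≤ 1) (hanti : Antitone P) (hQ0 : ∀ r R, 0 ≤ Q r R)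
    (hsub : ∀ r R : ℕ, 1 ≤ r → r < R → P R ≤ P r * Q r R)
    {m r₀ : ℕ} {b : ℝ} (hm : 2 ≤ m) (hr₀ : 1 ≤ r₀) (hb : 0 < b)
    (hQ : ∀ r : ℕ, r₀ ≤ r → Q r (m * r) ≤ (m : ℝ) ^ (-b)) :
    ∀ r : ℕ, 1 ≤ r → P r ≤ ((m : ℝ) * r₀) ^ b * (r : ℝ) ^ (-b) := by
  have hm1 : 1 < m := lt_of_lt_of_le one_lt_two hm
  have hmR : (0 : ℝ) < m := by exact_mod_cast (lt_trans zero_lt_one hm1)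
  have hr₀R : (0 : ℝ) < r₀ := by exact_mod_cast hr₀
  have hq0 : (0 : ℝ) ≤ (m : ℝ) ^ (-b) := Real.rpow_nonneg hmR.le _
  -- Step 1: geometric decay along the scales `m^k r₀`.
  have hgeo : ∀ k : ℕ, P (m ^ k * r₀) ≤ ((m : ℝ) ^ (-b)) ^ k := by
    intro k
    induction k with
    | zero => simpa using hP1 r₀
    | succ k ih =>
      have hmk : 1 ≤ m ^ k := Nat.one_le_pow _ _ (lt_trans zero_lt_one hm1)
      have hr : 1 ≤ m ^ k * r₀ := le_trans hr₀ (Nat.le_mul_of_pos_left r₀ hmk)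
      have hrR : m ^ k * r₀ < m ^ (k + 1) * r₀ :=
        Nat.mul_lt_mul_of_pos_right (Nat.pow_lt_pow_right hm1 (Nat.lt_succ_self k)) hr₀
      have h1 := hsub _ _ hr hrR
      have h2 : Q (m ^ k * r₀) (m ^ (k + 1) * r₀) ≤ (m : ℝ) ^ (-b) := by
        have h := hQ (m ^ k * r₀) (Nat.le_mul_of_pos_left r₀ hmk)
        have e : m * (m ^ k * r₀) = m ^ (k + 1) * r₀ := by ring
        rw [e] at h
        exact h
      calc P (m ^ (k + 1) * r₀) ≤ P (m ^ k * r₀) * Q (m ^ k * r₀) (m ^ (k + 1) * r₀) := h1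
        _ ≤ ((m : ℝ) ^ (-b)) ^ k * (m : ℝ) ^ (-b) := mul_le_mul ih h2 (hQ0 _ _) (pow_nonneg hq0 k)
        _ = ((m : ℝ) ^ (-b)) ^ (k + 1) := by rw [pow_succ]
  -- Step 2: every `r ≥ 1` sits in a window `m^k r₀ ≤ r < m^(k+1) r₀` (or below `r₀`, with `k = 0`).
  have hwin : ∀ r : ℕ, 1 ≤ r → ∃ k : ℕ, P r ≤ ((m : ℝ) ^ (-b)) ^ k ∧ (r : ℝ) ≤ (m : ℝ) ^ k * ((m : ℝ) * r₀) := by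
    intro r hr
    by_cases hlt : r < r₀
    · refine ⟨0, ?_, ?_⟩
      · simpa using hP1 r
      · have h1 : (r : ℝ) ≤ r₀ := by exact_mod_cast hlt.le
        have h2 : (r₀ : ℝ) ≤ (m : ℝ) * r₀ := le_mul_of_one_le_left hr₀R.le (by exact_mod_cast hm1.le)
        simpa using h1.trans h2
    · rw [not_lt] at hlt
      set n := r / r₀ with hn
      have hn0 : n ≠ 0 := by
        rw [hn]
        exact (Nat.div_pos hlt (lt_of_lt_of_le zero_lt_one hr₀)).ne'
      set k := Nat.log m n with hk
      refine ⟨k, ?_, ?_⟩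
      · -- `m^k r₀ ≤ r`, so `P r ≤ P (m^k r₀) ≤ (m^{-b})^k`
        have hle : m ^ k * r₀ ≤ r := by
          calc m ^ k * r₀ ≤ n * r₀ := Nat.mul_le_mul_right r₀ (Nat.pow_log_le_self m hn0)
            _ ≤ r := Nat.div_mul_le_self r r₀
        exact (hanti hle).trans (hgeo k)
      · -- `r < (n+1) r₀ ≤ m^(k+1) r₀ = m^k · (m r₀)`
        have hlt' : r < m ^ (k + 1) * r₀ := by
          have h1 : r < n * r₀ + r₀ := Nat.lt_div_mul_add (lt_of_lt_of_le zero_lt_one hr₀)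
          have h2 : n + 1 ≤ m ^ (k + 1) := Nat.lt_pow_succ_log_self hm1 n
          calc r < (n + 1) * r₀ := by simpa [add_mul] using h1
            _ ≤ m ^ (k + 1) * r₀ := Nat.mul_le_mul_right r₀ h2
        have h3 : (r : ℝ) ≤ ((m ^ (k + 1) * r₀ : ℕ) : ℝ) := by exact_mod_cast hlt'.le
        have e : ((m ^ (k + 1) * r₀ : ℕ) : ℝ) = (m : ℝ) ^ k * ((m : ℝ) * r₀) := by push_cast; ring
        rw [e] at h3
        exact h3
  -- Step 3: convert `(m^{-b})^k` into `(m r₀)^b · r^{-b}` on the window.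
  intro r hr
  obtain ⟨k, hPk, hrk⟩ := hwin r hr
  have hrR : (0 : ℝ) < r := by exact_mod_cast hr
  have hmk : (0 : ℝ) < (m : ℝ) ^ k := pow_pos hmR k
  have hmr₀ : (0 : ℝ) < (m : ℝ) * r₀ := mul_pos hmR hr₀R
  -- `(m^{-b})^k = (m^k)^{-b}`
  have e1 : ((m : ℝ) ^ (-b)) ^ k = ((m : ℝ) ^ k) ^ (-b) := by
    rw [← Real.rpow_natCast, ← Real.rpow_mul hmR.le, mul_comm, Real.rpow_mul hmR.le, Real.rpow_natCast]
  -- antitonicity of `x ↦ x^{-b}` on the window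
  have e2 : ((m : ℝ) ^ k * ((m : ℝ) * r₀)) ^ (-b) ≤ (r : ℝ) ^ (-b) :=
    Real.rpow_le_rpow_of_nonpos hrR hrk (by linarith)
  have e3 : ((m : ℝ) ^ k) ^ (-b) = ((m : ℝ) ^ k * ((m : ℝ) * r₀)) ^ (-b) * ((m : ℝ) * r₀) ^ b := by
    rw [Real.mul_rpow hmk.le hmr₀.le, mul_assoc, Real.rpow_neg hmr₀.le,
      inv_mul_cancel₀ (Real.rpow_pos_of_pos hmr₀ b).ne', mul_one]
  calc P r ≤ ((m : ℝ) ^ (-b)) ^ k := hPk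
    _ = ((m : ℝ) ^ k * ((m : ℝ) * r₀)) ^ (-b) * ((m : ℝ) * r₀) ^ b := by rw [e1, e3]
    _ ≤ (r : ℝ) ^ (-b) * ((m : ℝ) * r₀) ^ b :=
      mul_le_mul_of_nonneg_right e2 (Real.rpow_nonneg hmr₀.le b)
    _ = ((m : ℝ) * r₀) ^ b * (r : ℝ) ^ (-b) := mul_comm _ _

/-- The two stubs give the RADIUS rate `P_{p_c}(arm_H(0,r)) ≤ (m r₀)^b · r^{-b}` (`r ≥ 1`) for the `b > 4/5`
of the shell-decay stub: `rate_of_shell_bound` with `P r = P_{p_c}(armH r)`, `Q r R = P_{p_c}(ShellCross_H(r,R))`,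
the submultiplicativity stub at `p = p_c`, `armH_antitone` and `0 ≤ P ≤ 1`. [folklore] -/
theorem armH_rate_of_stubs (h₁ : ShellSubmultStmt) {m r₀ : ℕ} {b : ℝ} (hm : 2 ≤ m) (hr₀ : 1 ≤ r₀)
    (hb : 4 / 5 < b)
    (hQ : ∀ r : ℕ, r₀ ≤ r →
      (bondPercolation (zdGraph 3) (criticalProbI 3)).real
        {ω | ∃ w y : Site 3, (∀ i : Fin 3, |w i| ≤ (r : ℤ) + 1) ∧ (∃ i : Fin 3, ((m * r : ℕ) : ℤ) ≤ |y i|) ∧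
          ω ∈ openConnIn {x : Site 3 | 0 ≤ x 0 ∧ ∃ i : Fin 3, (r : ℤ) < |x i|} w y} ≤ (m : ℝ) ^ (-b)) :
    ∀ r : ℕ, 1 ≤ r →
      (bondPercolation (zdGraph 3) (criticalProbI 3)).real (armH r) ≤ ((m : ℝ) * r₀) ^ b * (r : ℝ) ^ (-b) := by
  refine rate_of_shell_bound (fun r => (bondPercolation (zdGraph 3) (criticalProbI 3)).real (armH r))
    (fun r R => (bondPercolation (zdGraph 3) (criticalProbI 3)).real
      {ω | ∃ w y : Site 3, (∀ i : Fin 3, |w i| ≤ (r : ℤ) + 1) ∧ (∃ i : Fin 3, (R : ℤ) ≤ |y i|) ∧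
        ω ∈ openConnIn {x : Site 3 | 0 ≤ x 0 ∧ ∃ i : Fin 3, (r : ℤ) < |x i|} w y})
    (fun r => measureReal_le_one)
    (fun r s hrs => measureReal_mono (armH_antitone hrs)) (fun r R => measureReal_nonneg)
    (fun r R hr hrR => h₁ (criticalProbI 3) r R hr hrR) hm hr₀ (by linarith) ?_
  intro r hr
  exact hQ r hr

/-! ## Composition: the two stubs prove the crux BY NAME -/

/-- **Composition (kernel-checked, no `sorry`).** `stub_shellSubmult → stub_shellDecayFourFifths →
HalfSpaceOneArmFourFifths`: unpack `m, r₀, b` (`b > 4/5`) from the shell-decay stub, get the radius rate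
`P_{p_c}(armH h) ≤ (m r₀)^b h^{-b}` from `armH_rate_of_stubs`, put `κ := b − 4/5 > 0`, `C := (m r₀)^b`, and use
`heightReach h ⊆ armH h`. -/
theorem HalfSpaceOneArmFourFifths_of (h₁ : __Registered.stub_shellSubmult)
    (h₂ : __Registered.stub_shellDecayFourFifths) :
    Summit.CriticalPhenomena.PercolationContinuityZ3.Theses.PercQuarantineIslands.HalfSpaceOneArmFourFifths := by
  obtain ⟨m, r₀, b, hm, hr₀, hb, hQ⟩ := h₂
  have hrate := armH_rate_of_stubs h₁ hm hr₀ hb hQ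
  rw [halfSpaceOneArmFourFifths_iff]
  refine ⟨b - 4 / 5, ((m : ℝ) * r₀) ^ b, by linarith, ?_⟩
  intro h hh
  have e : -(4 / 5 + (b - 4 / 5)) = -b := by ring
  rw [e]
  exact (real_heightReach_le_armH (criticalProbI 3) h).trans (hrate h hh)

/-- Wiring check: plugging the (sorried) registered stubs into the composition yields the crux — the
spelled-out stub signatures are definitionally the `__Registered.*` aliases. -/
example : Summit.CriticalPhenomena.PercolationContinuityZ3.Theses.PercQuarantineIslands.HalfSpaceOneArmFourFifths :=
  HalfSpaceOneArmFourFifths_of stub_shellSubmult stub_shellDecayFourFifths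

end Summit.CriticalPhenomena.PercolationContinuityZ3.Cruxes.HalfSpaceOneArmFourFifths.Birth

end
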